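import Summits.NavierStokesRegularity.NavierStokesRegularity.Theses.SelfMixingDichotomy
import Summits.NavierStokesRegularity.NavierStokesRegularity.Theorems.SelfMixingDichotomyCoherentScaleExclusionPassiveScalarL1Antitone
import Summits.NavierStokesRegularity.NavierStokesRegularity.Theorems.SelfMixingDichotomyCoherentScaleExclusionNashInequality
import Summits.NavierStokesRegularity.NavierStokesRegularity.Theorems.SelfMixingDichotomyCoherentScaleExclusionNashCeilingAssembly
import Summits.NavierStokesRegularity.NavierStokesRegularity.Theorems.SelfMixingDichotomyCoherentScaleExclusionLoadFloor
import HarnessLib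

/-!
# Crux `CoherentScaleExclusion` (stmt-NavierStokesRegularity-1423), line `registered`:
# the two FLOORS/CEILINGS of the scalar dissipation factor, unconditional

Support file (`--supports stmt-NavierStokesRegularity-1423`, lead c1 of the line). The crux S2 of
route `SelfMixingDichotomy` is stated through `MIX(u,T,x₀,r,δ)` =
`Literature.Analysis.FluidPDE.DissipatesAtScale u T x₀ r δ` (definitionally): every admissible
passive scalar launched from a blob in `B_r(x₀)` keeps at most the fraction `δ` of its `L²` norm
after half a diffusive time in the drift `u`. This file discharges the hypotheses of the three
registered pieces landed by the wave of lead c1 and records the two unconditional bounds on the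
dissipation factor of a standing Navier–Stokes velocity (`ν = 1`, classical on `[0,T)`,
Leray–Hopf, rapidly decaying datum):

* `coherentScaleExclusion_nashCeiling` — the **Nash ceiling**: a drift-INDEPENDENT `δ₀ ∈ (0,1)`
  such that `MIX(u,T,x₀,r,δ)` holds for every `δ ≥ δ₀`, every `x₀` and every `0 < r`, `r² ≤ T`
  (Nash 1958: the `L¹ → L²` decay of `∂ₜ − Δ + u·∇` is uniform over divergence-free drifts; glue
  of `stub_passiveScalarL1Antitone` (Kato), `stub_nashInequality`, `stub_nashCeilingAssembly`).
  Hence `coherentScaleExclusion_of_nashCeiling_le`: **the crux restricted to `δ ≥ δ₀` holds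
  outright** (its antecedent — recurrent NON-`δ`-mixing scales — is never met), improving the
  range `δ ≥ 1` of `coherentScaleExclusion_of_one_le`; the contentful range of S2 and of all three
  regime stubs of the line is `0 < δ < δ₀`.
* `coherentScaleExclusion_loadFloor` — the **load floor** ("at bounded Reynolds number nothing
  `δ`-mixes", the claim of the crux docstring; converse form of the route header's kill
  criterion (ii) "MIX(r,δ) forces C ≥ M(δ) → ∞"): for every `M₁ > 0` there are `δ₁(M₁) > 0` and
  `A(M₁) ≥ 1` such that `cknC (A r) (T,x₀) u ≤ M₁` forces `¬ MIX(u,T,x₀,r,δ₁)` (glue of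
  `stub_loadFloor` with the `L¹` bound from `stub_passiveScalarL1Antitone`). Hence
  `coherentScaleExclusion_notMix_recur_of_load_recur`: recurrent bounded-load scales (the
  antecedent of the sibling crux S1 `SequentialTypeIExclusion`) are always accompanied by
  recurrent non-`δ₁(M)`-mixing scales — the bridge that merges S1 and S2 into a single
  "non-mixing exclusion" statement (file `…CoherentScaleExclusionNonMixingExclusion`).

Everything here is unconditional (standard axioms); no definitions, no named facts.
-/

noncomputable section

-- `Summit = Problem` for this summit; the tree lakefile sets `weak.linter.dupNamespace = false`.
set_option linter.dupNamespace false

namespace Summit.NavierStokesRegularity.NavierStokesRegularity.Theorems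

open MeasureTheory Set Metric
open Literature.Analysis.FluidPDE
open Summit.NavierStokesRegularity.NavierStokesRegularity.Theses.SelfMixingDichotomy

/-! ### The Nash ceiling -/

/-- **The Nash ceiling for `C¹` divergence-free `L²` drifts (unconditional).** There is a
drift-independent `δ₀ ∈ (0,1)` such that for every `δ ≥ δ₀`, every drift `u` that is `C¹`,
divergence free and square integrable at each time of the window `[T − r², T − r²/2]`, every `x₀`
and every `r > 0`, `DissipatesAtScale u T x₀ r δ`: the three registered pieces
`stub_nashCeilingAssembly`, `stub_passiveScalarL1Antitone`, `stub_nashInequality` glued. -/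
theorem nashCeiling_of_isDivFree_memLp :
    ∃ δ₀ : ℝ, 0 < δ₀ ∧ δ₀ < 1 ∧ ∀ δ : ℝ, δ₀ ≤ δ →
      ∀ (u : ℝ → EuclideanSpace ℝ (Fin 3) → EuclideanSpace ℝ (Fin 3)) (T : ℝ)
        (x₀ : EuclideanSpace ℝ (Fin 3)) (r : ℝ), 0 < r →
      (∀ t ∈ Set.Icc (T - r ^ 2) (T - r ^ 2 / 2), ContDiff ℝ 1 (u t)) →
      (∀ t ∈ Set.Icc (T - r ^ 2) (T - r ^ 2 / 2), VectorCalculus.IsDivFree (u t)) →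
      (∀ t ∈ Set.Icc (T - r ^ 2) (T - r ^ 2 / 2), MemLp (u t) 2 (volume : Measure _)) →
      DissipatesAtScale u T x₀ r δ :=
  stub_nashCeilingAssembly stub_passiveScalarL1Antitone stub_nashInequality

/-- **The Nash ceiling for standing Navier–Stokes velocities (unconditional).** There is a
drift-independent `δ₀ ∈ (0,1)` such that for every `δ ≥ δ₀`, every classical solution `(u, p)` of
Navier–Stokes (`ν = 1`, `f = 0`) on `ℝ³ × [0,T)` whose velocity is Leray–Hopf on `[0,T]`, every
`x₀` and every scale `0 < r` with `r² ≤ T`, the drift `δ`-mixes at scale `r`: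
`DissipatesAtScale u T x₀ r δ` (the window `[T − r², T − r²/2]` lies in `[0,T)`, where the
slices `u t` are smooth, divergence free and square integrable). -/
theorem coherentScaleExclusion_nashCeiling : ∃ δ₀ : ℝ, 0 < δ₀ ∧ δ₀ < 1 ∧ ∀ δ : ℝ, δ₀ ≤ δ → ∀ T : ℝ, 0 < T → ∀ (u : ℝ → EuclideanSpace ℝ (Fin 3) → EuclideanSpace ℝ (Fin 3)) (p : ℝ → EuclideanSpace ℝ (Fin 3) → ℝ), Literature.Analysis.FluidPDE.IsClassicalNSSolutionOn (Set.Ico 0 T) 1 0 u p → Literature.Analysis.FluidPDE.IsLerayHopfOn T 1 0 (u 0) u → ∀ (x₀ : EuclideanSpace ℝ (Fin 3)) (r : ℝ), 0 < r → r ^ 2 ≤ T → Literature.Analysis.FluidPDE.DissipatesAtScale u T x₀ r δ := by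
  obtain ⟨δ₀, hδ₀, hδ₀1, hceil⟩ := nashCeiling_of_isDivFree_memLp
  refine ⟨δ₀, hδ₀, hδ₀1, fun δ hδ T _hT u p hcl hLH x₀ r hr hrT => ?_⟩
  have hwin : ∀ t ∈ Set.Icc (T - r ^ 2) (T - r ^ 2 / 2), t ∈ Set.Ico 0 T ∧ t ∈ Set.Icc 0 T := by
    intro t ht
    have hr2 : 0 < r ^ 2 := by positivity
    exact ⟨⟨by linarith [ht.1], by linarith [ht.2]⟩, ⟨by linarith [ht.1], by linarith [ht.2]⟩⟩
  exact hceil δ hδ u T x₀ r hr (fun t ht => contDiff_infty.1 (hcl.contDiff_velocity (hwin t ht).1) 1)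
    (fun t ht => hcl.divFree t (hwin t ht).1) (fun t ht => hLH.memLp t (hwin t ht).2)

/-- **The crux `CoherentScaleExclusion` holds outright in the range `δ ≥ δ₀` of the Nash ceiling
(unconditional; `δ₀ < 1` drift independent).** For such `δ` the antecedent of the crux —
non-`δ`-mixing loaded scales recurring down to `r → 0` — is never met by a standing solution
(`coherentScaleExclusion_nashCeiling` at every scale `r < √T`), so any threshold `M` works. This
strictly enlarges the empty range `δ ≥ 1` of `coherentScaleExclusion_of_one_le`; the contentful
range of the crux is `0 < δ < δ₀`. The conclusion is the body of the route decl verbatim. -/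
theorem coherentScaleExclusion_of_nashCeiling_le :
    ∃ δ₀ : ℝ, 0 < δ₀ ∧ δ₀ < 1 ∧ ∀ δ : ℝ, δ₀ ≤ δ → ∃ M : ℝ, ∀ T : ℝ, 0 < T → ∀ (u : ℝ → EuclideanSpace ℝ (Fin 3) → EuclideanSpace ℝ (Fin 3)) (p : ℝ → EuclideanSpace ℝ (Fin 3) → ℝ), Literature.Analysis.FluidPDE.IsClassicalNSSolutionOn (Set.Ico 0 T) 1 0 u p → Literature.Analysis.FluidPDE.IsLerayHopfOn T 1 0 (u 0) u → Literature.Analysis.FluidPDE.HasRapidSpatialDecay (u 0) → ∀ x₀ : EuclideanSpace ℝ (Fin 3), (∀ r₀ : ℝ, 0 < r₀ → ∃ r ∈ Set.Ioo 0 r₀, ENNReal.ofReal M ≤ Literature.Analysis.FluidPDE.cknC r ((T, x₀) : ℝ × EuclideanSpace ℝ (Fin 3)) u ∧ ¬ (∀ θ : ℝ → EuclideanSpace ℝ (Fin 3) → ℝ, Literature.Analysis.FluidPDE.IsSmoothSpaceTimeOn (Set.Icc (T - r ^ 2) (T - r ^ 2 / 2)) θ → Literature.Analysis.FluidPDE.HasUniformRapidDecayOn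 (Set.Icc (T - r ^ 2) (T - r ^ 2 / 2)) θ → (∀ t ∈ (Set.Icc (T - r ^ 2) (T - r ^ 2 / 2)), ∀ x : EuclideanSpace ℝ (Fin 3), Literature.Analysis.FluidPDE.timeDerivWithin (Set.Icc (T - r ^ 2) (T - r ^ 2 / 2)) θ t x + inner ℝ (u t x) (gradient (θ t) x) = Laplacian.laplacian (θ t) x) → Function.support (θ (T - r ^ 2)) ⊆ Metric.ball x₀ r → ∫ x, (θ (T - r ^ 2 / 2) x) ^ 2 ≤ δ ^ 2 * ∫ x, (θ (T - r ^ 2) x) ^ 2)) → (∃ ρ : ℝ, 0 < ρ ∧ ∃ M : ℝ, ∀ t ∈ Set.Ioo (T - ρ ^ 2) T, ∀ x ∈ Metric.ball x₀ ρ, ‖u t x‖ ≤ M) := by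
  obtain ⟨δ₀, hδ₀, hδ₀1, hceil⟩ := coherentScaleExclusion_nashCeiling
  refine ⟨δ₀, hδ₀, hδ₀1, fun δ hδ => ⟨0, fun T hT u p hcl hLH _hdec x₀ hRec => ?_⟩⟩
  exfalso
  obtain ⟨r, hr, -, hnot⟩ := hRec (Real.sqrt T) (Real.sqrt_pos.2 hT)
  refine hnot (hceil δ hδ T hT u p hcl hLH x₀ r hr.1 ?_)
  have h1 : r ^ 2 < (Real.sqrt T) ^ 2 := by nlinarith [hr.1, hr.2]
  rw [Real.sq_sqrt hT.le] at h1
  exact h1.le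

/-! ### The load floor -/

/-- **`L¹` bound for admissible passive scalars** (from the landed Kato contraction
`stub_passiveScalarL1Antitone`): on a slab `[a, b]`, in a `C¹` divergence-free `L²` drift,
`∫ |θ(t)| ≤ ∫ |θ(a)|` for every `t ∈ [a, b]` — the hypothesis of `stub_loadFloor`. -/
theorem coherentScaleExclusion_massBound :
    ∀ (a b : ℝ), a < b →
      ∀ (u : ℝ → EuclideanSpace ℝ (Fin 3) → EuclideanSpace ℝ (Fin 3)) (θ : ℝ → EuclideanSpace ℝ (Fin 3) → ℝ),
      Literature.Analysis.FluidPDE.IsSmoothSpaceTimeOn (Set.Icc a b) θ →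
      Literature.Analysis.FluidPDE.HasUniformRapidDecayOn (Set.Icc a b) θ →
      (∀ t ∈ Set.Icc a b, ∀ x : EuclideanSpace ℝ (Fin 3),
        Literature.Analysis.FluidPDE.timeDerivWithin (Set.Icc a b) θ t x + inner ℝ (u t x) (gradient (θ t) x) =
          Laplacian.laplacian (θ t) x) →
      (∀ t ∈ Set.Icc a b, ContDiff ℝ 1 (u t)) →
      (∀ t ∈ Set.Icc a b, Literature.Analysis.FluidPDE.VectorCalculus.IsDivFree (u t)) →
      (∀ t ∈ Set.Icc a b, MeasureTheory.MemLp (u t) 2 MeasureTheory.volume) →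
      ∀ t ∈ Set.Icc a b, ∫ x, |θ t x| ≤ ∫ x, |θ a x| :=
  fun a b hab u θ hθ hd hpde hu1 hdiv hu2 _ ht =>
    stub_passiveScalarL1Antitone a b hab u θ hθ hd hpde hu1 hdiv hu2 (Set.left_mem_Icc.2 hab.le) ht ht.1

/-- **The load floor (unconditional): at bounded local Reynolds number nothing `δ`-mixes.** For
every `M₁ > 0` there are `δ₁ = δ₁(M₁) > 0` and a comparison ratio `A = A(M₁) ≥ 1` such that for
every standing Navier–Stokes solution (`ν = 1`, classical on `[0,T)`, Leray–Hopf, rapidly decaying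
datum), every `x₀` and every scale `r > 0` with `(A r)² < T`: if the scaled load
`cknC (A r) (T, x₀) u = (A r)⁻² ∬_{Q_{Ar}(T,x₀)} |u|³` is at most `M₁`, then
`¬ DissipatesAtScale u T x₀ r δ₁` — some blob in `B_r(x₀)` keeps more than the fraction `δ₁` of
its `L²` norm (`stub_loadFloor` with the `L¹` bound `coherentScaleExclusion_massBound`). This is
the rigorous form of "M must grow as δ → 0 (at bounded Reynolds number nothing δ-mixes)" in the
crux docstring, and the converse form of the route header's kill criterion (ii). -/
theorem coherentScaleExclusion_loadFloor : ∀ M₁ : ℝ, 0 < M₁ → ∃ δ₁ : ℝ, 0 < δ₁ ∧ ∃ A : ℝ, 1 ≤ A ∧ ∀ T : ℝ, 0 < T → ∀ (u : ℝ → EuclideanSpace ℝ (Fin 3) → EuclideanSpace ℝ (Fin 3)) (p : ℝ → EuclideanSpace ℝ (Fin 3) → ℝ), Literature.Analysis.FluidPDE.IsClassicalNSSolutionOn (Set.Ico 0 T) 1 0 u p → Literature.Analysis.FluidPDE.IsLerayHopfOn T 1 0 (u 0) u → Literature.Analysis.FluidPDE.HasRapidSpatialDecay (u 0) → ∀ (x₀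 : EuclideanSpace ℝ (Fin 3)) (r : ℝ), 0 < r → (A * r) ^ 2 < T → Literature.Analysis.FluidPDE.cknC (A * r) ((T, x₀) : ℝ × EuclideanSpace ℝ (Fin 3)) u ≤ ENNReal.ofReal M₁ → ¬ Literature.Analysis.FluidPDE.DissipatesAtScale u T x₀ r δ₁ :=
  stub_loadFloor coherentScaleExclusion_massBound

/-- **Recurrent bounded-load scales carry recurrent non-mixing scales (unconditional).** For every
`M₁ > 0` there is `δ₁ = δ₁(M₁) > 0` such that at a final-time point `(T, x₀)` of a standing
solution where the load is at most `M₁` along some sequence of scales `ρ_k → 0` — the antecedent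
of the sibling crux S1 `SequentialTypeIExclusion` — the drift fails to `δ₁`-mix along the scales
`ρ_k / A(M₁) → 0` (`coherentScaleExclusion_loadFloor`). This is the bridge that turns the pair
(S1, S2) of the route into a single non-mixing exclusion statement. -/
theorem coherentScaleExclusion_notMix_recur_of_load_recur :
    ∀ M₁ : ℝ, 0 < M₁ → ∃ δ₁ : ℝ, 0 < δ₁ ∧ ∀ T : ℝ, 0 < T →
      ∀ (u : ℝ → EuclideanSpace ℝ (Fin 3) → EuclideanSpace ℝ (Fin 3)) (p : ℝ → EuclideanSpace ℝ (Fin 3) → ℝ),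
      IsClassicalNSSolutionOn (Set.Ico 0 T) 1 0 u p → IsLerayHopfOn T 1 0 (u 0) u →
      HasRapidSpatialDecay (u 0) → ∀ x₀ : EuclideanSpace ℝ (Fin 3),
      (∀ r₀ : ℝ, 0 < r₀ → ∃ r ∈ Set.Ioo 0 r₀,
        cknC r ((T, x₀) : ℝ × EuclideanSpace ℝ (Fin 3)) u ≤ ENNReal.ofReal M₁) →
      ∀ r₀ : ℝ, 0 < r₀ → ∃ r ∈ Set.Ioo 0 r₀, ¬ DissipatesAtScale u T x₀ r δ₁ := by
  intro M₁ hM₁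
  obtain ⟨δ₁, hδ₁, A, hA, hLF⟩ := coherentScaleExclusion_loadFloor M₁ hM₁
  refine ⟨δ₁, hδ₁, fun T hT u p hcl hLH hdec x₀ hlow r₀ hr₀ => ?_⟩
  have hA0 : 0 < A := lt_of_lt_of_le one_pos hA
  -- a low-load scale `ρ` below `min r₀ √T`, and the scale `ρ / A` under it
  obtain ⟨ρ, hρ, hρload⟩ := hlow (min r₀ (Real.sqrt T)) (lt_min hr₀ (Real.sqrt_pos.2 hT))
  have hρr₀ : ρ < r₀ := lt_of_lt_of_le hρ.2 (min_le_left _ _)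
  have hρT : ρ < Real.sqrt T := lt_of_lt_of_le hρ.2 (min_le_right _ _)
  have hρ2 : ρ ^ 2 < T := by
    have h1 : ρ ^ 2 < (Real.sqrt T) ^ 2 := by nlinarith [hρ.1]
    rwa [Real.sq_sqrt hT.le] at h1
  refine ⟨ρ / A, ⟨div_pos hρ.1 hA0, ?_⟩, ?_⟩
  · calc ρ / A ≤ ρ / 1 := by gcongr; exact hρ.1.le
      _ = ρ := div_one ρ
      _ < r₀ := hρr₀
  · have hAρ : A * (ρ / A) = ρ := by field_simp
    refine hLF T hT u p hcl hLH hdec x₀ (ρ / A) (div_pos hρ.1 hA0) (by rw [hAρ]; exact hρ2) ?_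
    rw [hAρ]
    exact hρload

end Summit.NavierStokesRegularity.NavierStokesRegularity.Theorems

end
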